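import Summits.CriticalPhenomena.Ising3D.Control2DRhoEnvelopeSharp
import Mathlib.Analysis.Normed.Group.Tannery
import Mathlib.Analysis.SpecialFunctions.Pow.Real
import Mathlib.Analysis.SpecialFunctions.Sqrt
import Mathlib.Tactic.Linarith
import Mathlib.Tactic.Positivity
import Mathlib.Tactic.FieldSimp
import Mathlib.Tactic.Ring
import Mathlib.Tactic.NormNum
import HarnessLib

/-!
# The `ρ`-envelope is tight: `k_{2h}(4ρ/(1+ρ)²)/(4ρ)^h = ₂F₁(½,h;h+½;ρ²)` increases in `h` from `1` to `(1-ρ²)^{-1/2}`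
(cell `pub-ising3x`, seat controls-1 gen 49; PAPER §6.2 / Appendix E.1z (ii) — CONTROL-ONLY; companion of `Control2DRhoExpansion`
and `Control2DRhoEnvelopeSharp`)

HONEST FRAMING: lottery ticket; floor = tightest certified 3D Ising CFT bounds; no exact-solution
claim without a proof. CONTROL-ONLY (`d = 2`, global `sl(2) × sl(2)` blocks); PURE BLOCK ANALYSIS (no datum): nothing here is
about `d = 3`, no certificate, functional or number of the record is touched, and no new hypothesis, definition or named fact
enters.

WHAT THIS FILE ADDS. E.1x proved `(4ρ)^h ≤ k_{2h}(4ρ/(1+ρ)²)` and E.1z proved `k_{2h}(4ρ/(1+ρ)²) ≤ (4ρ)^h (1-ρ²)^{-1/2}`, the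
`h`-free two-sided envelope. Both constants are OPTIMAL among `h`-free constants, because the ratio
`k_{2h}(4ρ/(1+ρ)²)/(4ρ)^h = ₂F₁(½,h;h+½;ρ²)` is MONOTONE in `h` and interpolates exactly between them:

* `poch_ratio_mono` — `(h₁)_n (h₂+½)_n ≤ (h₂)_n (h₁+½)_n` for `0 ≤ h₁ ≤ h₂` (each factor `(h+j)/(h+j+½)` increases with `h`);
  **`rhoCoeff_mono`** — the `ρ`-coefficients `b_n(h) = (½)_n (h)_n/(n!(h+½)_n)` are non-decreasing in `h ≥ 0`;
* **`ordinaryHypergeometric_half_mono`** — `₂F₁(½,h₁;h₁+½;x) ≤ ₂F₁(½,h₂;h₂+½;x)` for `0 ≤ h₁ ≤ h₂`, `0 ≤ x < 1`;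
  `chiralBlock_div_rpow_mono` — `k_{2h₁}(z)/(4ρ)^{h₁} ≤ k_{2h₂}(z)/(4ρ)^{h₂}` at `z = 4ρ/(1+ρ)²`; hence under a twist gap `h ≥ h₀`
  the lower envelope improves to **`chiralBlock_ge_rho_of_le`**: `(4ρ)^h · ₂F₁(½,h₀;h₀+½;ρ²) ≤ k_{2h}(4ρ/(1+ρ)²)` (E.1x is `h₀ = 0`);
* `tendsto_rhoCoeff_atTop` — `b_n(h) → (½)_n/n!` as `h → ∞`; **`tendsto_ordinaryHypergeometric_half_atTop`** —
  `₂F₁(½,h;h+½;x) → (1-x)^{-1/2}` as `h → ∞` (`0 ≤ x < 1`; Tannery's theorem with the dominant `(½)_n/n!·x^n` of E.1z's `rhoCoeff_le`);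
  **`tendsto_chiralBlock_div_rpow_atTop`** — `k_{2h}(4ρ/(1+ρ)²)/(4ρ)^h → 1/√(1-ρ²)` as `h → ∞`;
* **`rho_envelope_const_optimal`** — for every `c < 1/√(1-ρ²)` there is `h ≥ 0` with `c·(4ρ)^h < k_{2h}(4ρ/(1+ρ)²)`: no smaller
  `h`-free constant than Hogervorst–Rychkov's `(1-ρ²)^{-1/2}` bounds all blocks (and `h = 0`, `k_0 = 1 = (4ρ)^0`, attains E.1x's lower
  constant `1`: `chiralBlock_div_rpow_zero`).

NOT claimed: any rate in `h` of the convergence to `(1-ρ²)^{-1/2}`; anything at complex `ρ`; anything about a datum, a tail or the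
record; Virasoro; `d = 3`. References (CONTEXT, not inputs): M. Hogervorst, S. Rychkov, Phys. Rev. D 87 (2013) 106004, §2
[cite: HogervorstRychkov2013, §2]. Tree inputs by name: `chiralBlock_eq_rho` (`Control2DRhoExpansion`); `rhoCoeff_eq_poch`,
`rhoCoeff_nonneg`, `rhoCoeff_le` (`Control2DRhoEnvelopeSharp`); `chiralBlock_zero` (`Control2DBootstrap`); `poch`, `poch_succ`, `poch_pos`,
`hasSum_poch_div_factorial_mul_pow` (Literature `ConformalBootstrap3D.MeanFieldCoefficients` / `MeanFieldDecomposition`);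
`ascPochhammer_eval_eq_poch` (`Control2DGFFChiral`), `ascPochhammer_eval_nonneg` (`Control2DTermwise`); `hasSum_ordinaryHypergeometric`
(Literature `ZhouLegendreGreenValuesProofs`). Mathlib: `hasSum_le`, `tendsto_tsum_of_dominated_convergence` (Tannery), `tendsto_finsetProd`,
`Filter.Tendsto.div_atTop`, `Filter.tendsto_atTop_add_const_right`, `lt_mem_nhds`, `Filter.Eventually.exists`.
-/

namespace Summit.CriticalPhenomena.Ising3D.Control2D

open Set Filter Topology
open Literature.MathematicalPhysics.QuantumFieldTheory.ConformalBootstrap3D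
open Literature.NumberTheory.Automorphic.LegendreP (hasSum_ordinaryHypergeometric)

/-! ### The `ρ`-coefficients increase with `h` -/

/-- `(x)_n ≥ 0` for `x ≥ 0`. [folklore] -/
theorem poch_nonneg_of_nonneg {x : ℝ} (hx : 0 ≤ x) (n : ℕ) : 0 ≤ poch x n := by
  rw [← ascPochhammer_eval_eq_poch]
  exact ascPochhammer_eval_nonneg n hx

/-- The cross-multiplied monotonicity of `(h)_n/(h+½)_n = Π_{j<n} (h+j)/(h+j+½)`: for `0 ≤ h₁ ≤ h₂`,
`(h₁)_n·(h₂+½)_n ≤ (h₂)_n·(h₁+½)_n` (induction on `n`; the step is `(h₁+n)(h₂+½+n) ≤ (h₂+n)(h₁+½+n) ⇔ h₁ ≤ h₂`). [folklore] -/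
theorem poch_ratio_mono {h₁ h₂ : ℝ} (h0 : 0 ≤ h₁) (h12 : h₁ ≤ h₂) :
    ∀ n : ℕ, poch h₁ n * poch (h₂ + 1 / 2) n ≤ poch h₂ n * poch (h₁ + 1 / 2) n
  | 0 => by simp
  | n + 1 => by
    rw [poch_succ, poch_succ, poch_succ, poch_succ]
    have ih := poch_ratio_mono h0 h12 n
    have hstep : (h₁ + n) * (h₂ + 1 / 2 + n) ≤ (h₂ + n) * (h₁ + 1 / 2 + n) := by nlinarith
    have hn : (0 : ℝ) ≤ n := Nat.cast_nonneg n
    have hB : 0 ≤ poch h₂ n * poch (h₁ + 1 / 2) n :=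
      mul_nonneg (poch_nonneg_of_nonneg (h0.trans h12) n) (poch_pos (by linarith) n).le
    calc poch h₁ n * (h₁ + n) * (poch (h₂ + 1 / 2) n * (h₂ + 1 / 2 + n))
        = (poch h₁ n * poch (h₂ + 1 / 2) n) * ((h₁ + n) * (h₂ + 1 / 2 + n)) := by ring
      _ ≤ (poch h₂ n * poch (h₁ + 1 / 2) n) * ((h₂ + n) * (h₁ + 1 / 2 + n)) :=
          mul_le_mul ih hstep (mul_nonneg (by linarith) (by linarith)) hB
      _ = _ := by ring

/-- **The `ρ`-coefficients increase with `h`**: `b_n(h₁) ≤ b_n(h₂)` for `0 ≤ h₁ ≤ h₂`, where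
`b_n(h) = (½)_n (h)_n/(n!(h+½)_n)` is Mathlib's `ordinaryHypergeometricCoefficient (1/2) h (h+1/2) n`. [folklore] -/
theorem rhoCoeff_mono {h₁ h₂ : ℝ} (h0 : 0 ≤ h₁) (h12 : h₁ ≤ h₂) (n : ℕ) :
    ordinaryHypergeometricCoefficient (1 / 2 : ℝ) h₁ (h₁ + 1 / 2) n ≤
      ordinaryHypergeometricCoefficient (1 / 2 : ℝ) h₂ (h₂ + 1 / 2) n := by
  rw [rhoCoeff_eq_poch, rhoCoeff_eq_poch]
  have hp : 0 < poch (1 / 2 : ℝ) n := poch_pos (by norm_num) n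
  have hq₁ : 0 < poch (h₁ + 1 / 2) n := poch_pos (by linarith) n
  have hq₂ : 0 < poch (h₂ + 1 / 2) n := poch_pos (by linarith) n
  have hf : 0 < (n.factorial : ℝ) := by positivity
  rw [div_le_div_iff₀ (by positivity) (by positivity)]
  have key := poch_ratio_mono h0 h12 n
  calc poch (1 / 2) n * poch h₁ n * ((n.factorial : ℝ) * poch (h₂ + 1 / 2) n)
      = (poch (1 / 2) n * (n.factorial : ℝ)) * (poch h₁ n * poch (h₂ + 1 / 2) n) := by ring
    _ ≤ (poch (1 / 2) n * (n.factorial : ℝ)) * (poch h₂ n * poch (h₁ + 1 / 2) n) :=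
        mul_le_mul_of_nonneg_left key (by positivity)
    _ = _ := by ring

/-! ### Monotonicity in `h` of `₂F₁(½,h;h+½;·)` and of the block ratio -/

/-- **`h ↦ ₂F₁(½,h;h+½;x)` is non-decreasing on `[0,∞)`** for `0 ≤ x < 1` (termwise, `rhoCoeff_mono`). [folklore] -/
theorem ordinaryHypergeometric_half_mono {h₁ h₂ x : ℝ} (h0 : 0 ≤ h₁) (h12 : h₁ ≤ h₂) (hx0 : 0 ≤ x) (hx1 : x < 1) :
    ordinaryHypergeometric (1 / 2) h₁ (h₁ + 1 / 2) x ≤ ordinaryHypergeometric (1 / 2) h₂ (h₂ + 1 / 2) x := by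
  have habs : |x| < 1 := by rw [abs_of_nonneg hx0]; exact hx1
  exact hasSum_le (fun n => mul_le_mul_of_nonneg_right (rhoCoeff_mono h0 h12 n) (pow_nonneg hx0 n))
    (hasSum_ordinaryHypergeometric _ _ _ habs) (hasSum_ordinaryHypergeometric _ _ _ habs)

/-- The block ratio `k_{2h}(4ρ/(1+ρ)²)/(4ρ)^h` equals `₂F₁(½,h;h+½;ρ²)` (`chiralBlock_eq_rho` divided). [cite: HogervorstRychkov2013, §2] -/
theorem chiralBlock_div_rpow_eq {h : ℝ} (hh : 0 ≤ h) {ρ : ℝ} (hρ : ρ ∈ Ioo (0 : ℝ) 1) :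
    chiralBlock h (4 * ρ / (1 + ρ) ^ 2) / (4 * ρ) ^ h = ordinaryHypergeometric (1 / 2) h (h + 1 / 2) (ρ ^ 2) := by
  have h4 : 0 < (4 * ρ) ^ h := Real.rpow_pos_of_pos (by linarith [hρ.1]) h
  rw [chiralBlock_eq_rho hh hρ, mul_div_cancel_left₀ _ h4.ne']

/-- At `h = 0` the ratio is `1`: E.1x's lower constant is attained (`k_0 = 1 = (4ρ)^0`). [folklore] -/
theorem chiralBlock_div_rpow_zero (ρ : ℝ) : chiralBlock 0 (4 * ρ / (1 + ρ) ^ 2) / (4 * ρ) ^ (0 : ℝ) = 1 := by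
  rw [chiralBlock_zero, Real.rpow_zero, div_one]

/-- **The block ratio increases with `h`**: `k_{2h₁}(z)/(4ρ)^{h₁} ≤ k_{2h₂}(z)/(4ρ)^{h₂}` at `z = 4ρ/(1+ρ)²` for `0 ≤ h₁ ≤ h₂`,
`ρ ∈ (0,1)`. [folklore] -/
theorem chiralBlock_div_rpow_mono {h₁ h₂ : ℝ} (h0 : 0 ≤ h₁) (h12 : h₁ ≤ h₂) {ρ : ℝ} (hρ : ρ ∈ Ioo (0 : ℝ) 1) :
    chiralBlock h₁ (4 * ρ / (1 + ρ) ^ 2) / (4 * ρ) ^ h₁ ≤ chiralBlock h₂ (4 * ρ / (1 + ρ) ^ 2) / (4 * ρ) ^ h₂ := by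
  have hx1 : ρ ^ 2 < 1 := by nlinarith [hρ.1, hρ.2]
  rw [chiralBlock_div_rpow_eq h0 hρ, chiralBlock_div_rpow_eq (h0.trans h12) hρ]
  exact ordinaryHypergeometric_half_mono h0 h12 (sq_nonneg ρ) hx1

/-- **The lower envelope under a twist gap**: for `0 ≤ h₀ ≤ h` and `ρ ∈ (0,1)`,
`(4ρ)^h · ₂F₁(½,h₀;h₀+½;ρ²) ≤ k_{2h}(4ρ/(1+ρ)²)` — E.1x's `(4ρ)^h ≤ k_{2h}` is the case `h₀ = 0`. [folklore] -/
theorem chiralBlock_ge_rho_of_le {h₀ h : ℝ} (hh₀ : 0 ≤ h₀) (hle : h₀ ≤ h) {ρ : ℝ} (hρ : ρ ∈ Ioo (0 : ℝ) 1) :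
    (4 * ρ) ^ h * ordinaryHypergeometric (1 / 2) h₀ (h₀ + 1 / 2) (ρ ^ 2) ≤ chiralBlock h (4 * ρ / (1 + ρ) ^ 2) := by
  have hx1 : ρ ^ 2 < 1 := by nlinarith [hρ.1, hρ.2]
  rw [chiralBlock_eq_rho (hh₀.trans hle) hρ]
  exact mul_le_mul_of_nonneg_left (ordinaryHypergeometric_half_mono hh₀ hle (sq_nonneg ρ) hx1)
    (Real.rpow_nonneg (by linarith [hρ.1]) h)

/-! ### The limit `h → ∞`: Hogervorst–Rychkov's constant `(1-ρ²)^{-1/2}` is approached -/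

/-- `b_n(h) → (½)_n/n!` as `h → ∞` (each factor `(h+j)/(h+j+½) → 1`). [folklore] -/
theorem tendsto_rhoCoeff_atTop (n : ℕ) :
    Tendsto (fun h : ℝ => ordinaryHypergeometricCoefficient (1 / 2 : ℝ) h (h + 1 / 2) n) atTop
      (𝓝 (poch (1 / 2) n / (n.factorial : ℝ))) := by
  have e : ∀ h : ℝ, 0 < h → ordinaryHypergeometricCoefficient (1 / 2 : ℝ) h (h + 1 / 2) n =
      poch (1 / 2) n / (n.factorial : ℝ) * ∏ i ∈ Finset.range n, (h + i) / (h + 1 / 2 + i) := by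
    intro h hh
    rw [rhoCoeff_eq_poch, Finset.prod_div_distrib]
    have hq : 0 < poch (h + 1 / 2) n := poch_pos (by linarith) n
    change _ = _ * (poch h n / poch (h + 1 / 2) n)
    field_simp
  have lim : ∀ i : ℕ, Tendsto (fun h : ℝ => (h + i) / (h + 1 / 2 + i)) atTop (𝓝 1) := by
    intro i
    have hden : Tendsto (fun h : ℝ => h + 1 / 2 + (i : ℝ)) atTop atTop :=
      tendsto_atTop_add_const_right _ _ (tendsto_atTop_add_const_right _ _ tendsto_id)
    have h0 : Tendsto (fun h : ℝ => (1 / 2 : ℝ) / (h + 1 / 2 + i)) atTop (𝓝 0) := tendsto_const_nhds.div_atTop hden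
    have h1 : Tendsto (fun h : ℝ => 1 - (1 / 2 : ℝ) / (h + 1 / 2 + i)) atTop (𝓝 (1 - 0)) := tendsto_const_nhds.sub h0
    rw [sub_zero] at h1
    refine h1.congr' ?_
    filter_upwards [eventually_gt_atTop (0 : ℝ)] with h hh
    have hi : (0 : ℝ) ≤ i := Nat.cast_nonneg i
    field_simp
    ring
  have limP : Tendsto (fun h : ℝ => ∏ i ∈ Finset.range n, (h + i) / (h + 1 / 2 + i)) atTop (𝓝 1) := by
    have := tendsto_finsetProd (Finset.range n) (fun i _ => lim i)
    simpa using this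
  have limF := (tendsto_const_nhds (x := poch (1 / 2) n / (n.factorial : ℝ))).mul limP
  rw [mul_one] at limF
  refine limF.congr' ?_
  filter_upwards [eventually_gt_atTop (0 : ℝ)] with h hh
  exact (e h hh).symm

/-- **`₂F₁(½,h;h+½;x) → (1-x)^{-1/2}` as `h → ∞`** for `0 ≤ x < 1` — Tannery's theorem (dominated convergence for series): every term
`b_n(h)x^n → ((½)_n/n!)x^n` and `0 ≤ b_n(h)x^n ≤ ((½)_n/n!)x^n`, the summable binomial series of `(1-x)^{-1/2}`. [folklore] -/
theorem tendsto_ordinaryHypergeometric_half_atTop {x : ℝ} (hx0 : 0 ≤ x) (hx1 : x < 1) :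
    Tendsto (fun h : ℝ => ordinaryHypergeometric (1 / 2) h (h + 1 / 2) x) atTop (𝓝 (1 / (1 - x) ^ (1 / 2 : ℝ))) := by
  have habs : |x| < 1 := by rw [abs_of_nonneg hx0]; exact hx1
  have hB := hasSum_poch_div_factorial_mul_pow (1 / 2) habs
  have hF : ∀ h : ℝ, ordinaryHypergeometric (1 / 2) h (h + 1 / 2) x =
      ∑' n : ℕ, ordinaryHypergeometricCoefficient (1 / 2 : ℝ) h (h + 1 / 2) n * x ^ n :=
    fun h => (hasSum_ordinaryHypergeometric _ _ _ habs).tsum_eq.symm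
  rw [← hB.tsum_eq]
  simp_rw [hF]
  refine tendsto_tsum_of_dominated_convergence (bound := fun n : ℕ => poch (1 / 2) n / (n.factorial : ℝ) * x ^ n)
    hB.summable (fun n => (tendsto_rhoCoeff_atTop n).mul tendsto_const_nhds) ?_
  filter_upwards [eventually_ge_atTop (0 : ℝ)] with h hh n
  rw [Real.norm_eq_abs, abs_of_nonneg (mul_nonneg (rhoCoeff_nonneg hh n) (pow_nonneg hx0 n))]
  exact mul_le_mul_of_nonneg_right (rhoCoeff_le hh n) (pow_nonneg hx0 n)

/-- **The block ratio tends to Hogervorst–Rychkov's constant**: `k_{2h}(4ρ/(1+ρ)²)/(4ρ)^h → 1/√(1-ρ²)` as `h → ∞`, `ρ ∈ (0,1)`.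
[cite: HogervorstRychkov2013, §2] -/
theorem tendsto_chiralBlock_div_rpow_atTop {ρ : ℝ} (hρ : ρ ∈ Ioo (0 : ℝ) 1) :
    Tendsto (fun h : ℝ => chiralBlock h (4 * ρ / (1 + ρ) ^ 2) / (4 * ρ) ^ h) atTop
      (𝓝 (1 / Real.sqrt (1 - ρ ^ 2))) := by
  have hx1 : ρ ^ 2 < 1 := by nlinarith [hρ.1, hρ.2]
  rw [Real.sqrt_eq_rpow]
  refine (tendsto_ordinaryHypergeometric_half_atTop (sq_nonneg ρ) hx1).congr' ?_
  filter_upwards [eventually_ge_atTop (0 : ℝ)] with h hh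
  exact (chiralBlock_div_rpow_eq hh hρ).symm

/-- **The envelope constant is optimal**: for every `c < 1/√(1-ρ²)` some block violates `k_{2h} ≤ c·(4ρ)^h`, i.e. there is
`h ≥ 0` with `c·(4ρ)^h < k_{2h}(4ρ/(1+ρ)²)` — E.1z's `(4ρ)^h(1-ρ²)^{-1/2}` is the best `h`-free upper envelope, as E.1x's `(4ρ)^h` is
the best lower one (attained at `h = 0`). [folklore] -/
theorem rho_envelope_const_optimal {ρ : ℝ} (hρ : ρ ∈ Ioo (0 : ℝ) 1) {c : ℝ} (hc : c < 1 / Real.sqrt (1 - ρ ^ 2)) :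
    ∃ h : ℝ, 0 ≤ h ∧ c * (4 * ρ) ^ h < chiralBlock h (4 * ρ / (1 + ρ) ^ 2) := by
  have ev := ((tendsto_chiralBlock_div_rpow_atTop hρ).eventually (lt_mem_nhds hc)).and
    (eventually_ge_atTop (0 : ℝ))
  obtain ⟨h, hlt, hh⟩ := ev.exists
  have h4 : 0 < (4 * ρ) ^ h := Real.rpow_pos_of_pos (by linarith [hρ.1]) h
  refine ⟨h, hh, ?_⟩
  rwa [lt_div_iff₀ h4] at hlt

/-- **Summary: the two-sided `ρ`-envelope and its tightness in one statement.** For `ρ ∈ (0,1)` and `z = 4ρ/(1+ρ)²`: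
the ratio `r(h) = k_{2h}(z)/(4ρ)^h` satisfies `r(0) = 1`, `r` is non-decreasing on `[0,∞)`, `1 ≤ r(h) ≤ 1/√(1-ρ²)` for every
`h ≥ 0`, and `r(h) → 1/√(1-ρ²)` as `h → ∞`. [cite: HogervorstRychkov2013, §2] -/
theorem rho_envelope_tight {ρ : ℝ} (hρ : ρ ∈ Ioo (0 : ℝ) 1) :
    chiralBlock 0 (4 * ρ / (1 + ρ) ^ 2) / (4 * ρ) ^ (0 : ℝ) = 1 ∧
    (∀ h₁ h₂ : ℝ, 0 ≤ h₁ → h₁ ≤ h₂ →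
      chiralBlock h₁ (4 * ρ / (1 + ρ) ^ 2) / (4 * ρ) ^ h₁ ≤ chiralBlock h₂ (4 * ρ / (1 + ρ) ^ 2) / (4 * ρ) ^ h₂) ∧
    (∀ h : ℝ, 0 ≤ h → 1 ≤ chiralBlock h (4 * ρ / (1 + ρ) ^ 2) / (4 * ρ) ^ h ∧
      chiralBlock h (4 * ρ / (1 + ρ) ^ 2) / (4 * ρ) ^ h ≤ 1 / Real.sqrt (1 - ρ ^ 2)) ∧
    Tendsto (fun h : ℝ => chiralBlock h (4 * ρ / (1 + ρ) ^ 2) / (4 * ρ) ^ h) atTop (𝓝 (1 / Real.sqrt (1 - ρ ^ 2))) := by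
  refine ⟨chiralBlock_div_rpow_zero ρ, fun h₁ h₂ h0 h12 => chiralBlock_div_rpow_mono h0 h12 hρ, fun h hh => ?_,
    tendsto_chiralBlock_div_rpow_atTop hρ⟩
  have h4 : 0 < (4 * ρ) ^ h := Real.rpow_pos_of_pos (by linarith [hρ.1]) h
  constructor
  · rw [le_div_iff₀ h4, one_mul]
    exact rpow_four_mul_le_chiralBlock hh hρ
  · rw [div_le_iff₀ h4, div_mul_eq_mul_div, one_mul]
    exact chiralBlock_le_rho_sharp hh hρ

end Summit.CriticalPhenomena.Ising3D.Control2D
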